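import Literature.InformationTheory.QuantumCodes.IrreducibleCountingThreshold
import Literature.InformationTheory.QuantumCodes.ErasureDecoding
import HarnessLib

/-!
# Erasures AND independent errors on a CSS LDPC code: the Dumer–Kovalev–Pryadko threshold
# `(w-1)·Υ_CSS(y,p) < 1`, `Υ_CSS(y,p) = y + 2(1-y)√(p(1-p))` (Theorem 2, one error type)

Topic `Literature/InformationTheory/QuantumCodes` (venture QEC, LADDER-QEC rung Q5; qec-lit-2). PROVED, no
named fact, kernel axioms. This is Theorem 2 of Dumer, Kovalev, Pryadko (PRL 115 (2015) 050502) for one error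
type of a CSS code in full: "Any sequence of CSS codes [`d ≥ D ln n`] with generator weights not exceeding `w_X`,
`w_Z` can be decoded with vanishing error probabilities if channel probabilities `(y, p_X, p_Z)` for erasures
and independent `X/Z` errors satisfy `(w_X - 1) Υ_CSS(y, p_Z) ≤ e^{-1/D}`, `(w_Z - 1) Υ_CSS(y, p_X) ≤ e^{-1/D}`,
where `Υ_CSS(y,p) ≡ y + 2(1-y)[p(1-p)]^{1/2}`." Its two boundary cases are the tree's
`CSSErasureThreshold.lean` (`p = 0`: `(w-1) y < 1`) and `IrreducibleCountingThreshold.lean` (`y = 0`: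
`2(w-1)√(p(1-p)) < 1`); the present file proves the interpolating statement by the printed argument
(Appendix A "Effective erasure probabilities", §1.1 "CSS code with erasures and independent `X/Z` errors":
"Consider … [an] irreducible operator `U` of weight `m`. Fix erasure probability `y` … An erasure … and an
error … the net probability … The base of the exponent is the effective erasure probability").

**Model** (one error type, say `Z`; qubits `V`; the `X`-checks `H : Matrix ι V 𝔽₂` detecting `Z`-errors,
each of weight `≤ w`; trivial `Z`-errors `SX`, e.g. the row space of `H_Z`). Each qubit is erased
independently with probability `y` (pattern `Er`, KNOWN to the decoder) and, independently, suffers an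
error with probability `p` (pattern `E`; on erased qubits the actual error is arbitrary — the channel
randomises them — and the statements below are uniform in it). The decoder is an `ErasureDecoder`
(`ErasureDecoding.lean`) fed with `Er` and the syndrome; DKP15's decoder "returns the Pauli operator `E` …
that produces the given syndrome and maximizes `P(E)`", i.e. (erased positions being free) MINIMISES THE
NUMBER OF NON-ERASED ERROR POSITIONS: `IsMinWeightOutside`. Failure = the net error is a non-trivial logical.
`mixedFailureProb D y p` is the probability, over `(Er, E)`, that SOME error agreeing with `E` off `Er`
(arbitrary on `Er`) makes `D` fail — the robust form, which dominates every conditional law on `Er`.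

**Results.** `card_sdiff_le_two_mul_of_minWeightOutside` (half-weight off the erasure),
`exists_irreducible_of_mixed_failure` (failure ⇒ irreducible `U`, `𝟙_U ∉ SX`, `|U∖Er| ≤ 2|(U∖Er) ∩ E|`:
the bad event `ℬ(U)`), `sum_bernoulliWeight_pow_card_sdiff` (`E_y[(2s)^{|U∖Er|}] = Υ^{|U|}`, the binomial
identity of App. A), `mixedFailureProb_le` (`Σ ≤ |V| ((w-1)Υ)^d / ((w-1)(1-(w-1)Υ))`), the family form
`cssMixedThreshold` (`(w-1)Υ < 1`, subexponential family ⇒ `→ 0`), and non-vacuity of the decoder class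
(`minWeightOutside`, `minWeightOutside_isMinWeightOutside`). Toric code (`w = 4`): `3(y + 2(1-y)√(p(1-p))) < 1`.

## References

* [DumerKovalevPryadko2015] I. Dumer, A. A. Kovalev, L. P. Pryadko, PRL 115 (2015) 050502, arXiv:1412.6172
  (held `paper:arxiv-1412.6172`): Thm. 2 and `Υ_CSS` (chunk p0003 L96–110); min-energy decoder and
  `ℬ(U)` (p0004 L15–66); App. A §1.1 eqs. (prob-erasures-xz)–(threshold-CSS) (chunk p0008 L1–63).
-/

namespace Literature.InformationTheory.QuantumCodes

open Finset Matrix Filter Topology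

variable {ι V : Type*} [Fintype V] [DecidableEq V]

/-! ### The decoder: minimum weight outside the erasure -/

/-- DKP15's decoder for the mixed channel, one error type: given the erasure `Er` and the syndrome `H e`,
return a syndrome-matching correction with the LEAST NUMBER OF NON-ERASED POSITIONS (erased positions are
free: the channel randomises them, so every error on them is equally likely) — "returns the Pauli operator
… that produces the given syndrome and maximizes `P(E)`". (definition)
[cite: DumerKovalevPryadko2015, p. 3 (syndrome-based decoder maximizing P(E))] -/
def ErasureDecoder.IsMinWeightOutside (D : ErasureDecoder V (ι → ZMod 2)) (H : Matrix ι V (ZMod 2)) :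
    Prop :=
  ∀ (Er : Finset V) (e : V → ZMod 2), H *ᵥ D Er (H *ᵥ e) = H *ᵥ e ∧
    ∀ x : V → ZMod 2, H *ᵥ x = H *ᵥ e → (supp (D Er (H *ᵥ e)) \ Er).card ≤ (supp x \ Er).card

omit [DecidableEq V] in
/-- Membership in the support. [folklore] -/
private theorem mem_supp_iff'' {x : V → ZMod 2} {v : V} : v ∈ supp x ↔ x v ≠ 0 := by
  simp [supp]

/-- In `𝔽₂`, a non-zero element is `1`. [folklore] -/
private theorem zmod2_eq_one'' {a : ZMod 2} (h : a ≠ 0) : a = 1 := by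
  revert a; decide

open Classical in
/-- **Non-vacuity**: the canonical minimum-weight-outside-the-erasure decoder (choose, among the vectors
with the observed syndrome — the true error is one — one minimising the number of non-erased positions).
[cite: DumerKovalevPryadko2015, p. 3 ("This error can in principle be found, e.g., by an exhaustive search")] -/
noncomputable def ErasureDecoder.minWeightOutside (H : Matrix ι V (ZMod 2)) :
    ErasureDecoder V (ι → ZMod 2) := fun Er s =>
  if h : ∃ x : V → ZMod 2, H *ᵥ x = s then
    Classical.choose (Finset.exists_min_image (univ.filter fun x : V → ZMod 2 => H *ᵥ x = s)
      (fun x => (supp x \ Er).card) ⟨Classical.choose h, by simpa using Classical.choose_spec h⟩)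
  else 0

/-- The canonical decoder is a minimum-weight-outside-the-erasure decoder.
[cite: DumerKovalevPryadko2015, p. 3 (exhaustive search)] -/
theorem ErasureDecoder.minWeightOutside_isMinWeightOutside (H : Matrix ι V (ZMod 2)) :
    (ErasureDecoder.minWeightOutside H).IsMinWeightOutside H := by
  classical
  intro Er e
  have h : ∃ x : V → ZMod 2, H *ᵥ x = H *ᵥ e := ⟨e, rfl⟩
  have hne : (univ.filter fun x : V → ZMod 2 => H *ᵥ x = H *ᵥ e).Nonempty := ⟨e, by simp⟩
  set m := Classical.choose (Finset.exists_min_image (univ.filter fun x : V → ZMod 2 => H *ᵥ x = H *ᵥ e)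
    (fun x => (supp x \ Er).card) hne) with hm
  have hspec := Classical.choose_spec (Finset.exists_min_image
    (univ.filter fun x : V → ZMod 2 => H *ᵥ x = H *ᵥ e) (fun x => (supp x \ Er).card) hne)
  have hD : ErasureDecoder.minWeightOutside H Er (H *ᵥ e) = m := by
    unfold ErasureDecoder.minWeightOutside
    rw [dif_pos h]
  rw [hD, hm]
  refine ⟨(mem_filter.1 hspec.1).2, fun x hx => hspec.2 x ?_⟩
  exact mem_filter.2 ⟨mem_univ _, hx⟩

/-! ### The bad event: half of the non-erased part of an irreducible operator is faulty -/

/-- **Half-weight off the erasure.** If `e'` has the syndrome of `e` and the least number of non-erased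
positions in its syndrome class, and `W ⊆ supp(e + e')` is undetectable, then at least half of the
NON-ERASED qubits of `W` carry errors: `|W ∖ Er| ≤ 2 |(W ∖ Er) ∩ supp e|` (compare `e'` with `e' + 𝟙_W`).
[cite: DumerKovalevPryadko2015, eq. (min-E-condition) (ε(UE) ≤ ε(E), mixed channel App. A §1.1)] -/
theorem card_sdiff_le_two_mul_of_minWeightOutside (H : Matrix ι V (ZMod 2)) {e e' : V → ZMod 2}
    {Er : Finset V} (hsyn : H *ᵥ e' = H *ᵥ e)
    (hmin : ∀ x : V → ZMod 2, H *ᵥ x = H *ᵥ e → (supp e' \ Er).card ≤ (supp x \ Er).card)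
    {W : Finset V} (hW : W ⊆ supp (e + e')) (hWu : IsUndetectable H W) :
    (W \ Er).card ≤ 2 * ((W \ Er) ∩ supp e).card := by
  classical
  set x : V → ZMod 2 := e' + vecOf W with hx
  have hsynx : H *ᵥ x = H *ᵥ e := by
    rw [hx, Matrix.mulVec_add, hsyn]
    unfold IsUndetectable at hWu
    rw [hWu, add_zero]
  have hle := hmin x hsynx
  -- the support of `x`
  have hsuppx : supp x = (supp e' \ W) ∪ (W \ supp e') := by
    ext v
    rw [mem_union, Finset.mem_sdiff, Finset.mem_sdiff, mem_supp_iff'', mem_supp_iff'', hx, Pi.add_apply]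
    by_cases hv : v ∈ W
    · rw [vecOf_apply_of_mem hv]
      constructor
      · intro h
        right
        refine ⟨hv, fun h1 => ?_⟩
        rw [zmod2_eq_one'' h1] at h
        exact h (by decide)
      · rintro (⟨-, h2⟩ | ⟨-, h2⟩)
        · exact (h2 hv).elim
        · intro h
          apply h2
          intro h0
          rw [h0, zero_add] at h
          exact one_ne_zero h
    · rw [vecOf_apply_of_not_mem hv, add_zero]
      constructor
      · intro h
        exact Or.inl ⟨h, hv⟩
      · rintro (⟨h1, -⟩ | ⟨h1, -⟩)
        · exact h1
        · exact (hv h1).elim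
  -- restrict everything to the non-erased qubits `N = Erᶜ`
  have hsplitx : supp x \ Er = ((supp e' \ W) \ Er) ∪ ((W \ supp e') \ Er) := by
    rw [hsuppx, Finset.union_sdiff_distrib]
  have hdisj : Disjoint ((supp e' \ W) \ Er) ((W \ supp e') \ Er) := by
    rw [Finset.disjoint_left]
    intro v h1 h2
    exact (Finset.mem_sdiff.1 (Finset.mem_sdiff.1 h1).1).2 (Finset.mem_sdiff.1 (Finset.mem_sdiff.1 h2).1).1
  have hcardx : (supp x \ Er).card = ((supp e' \ W) \ Er).card + ((W \ supp e') \ Er).card := by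
    rw [hsplitx, card_union_of_disjoint hdisj]
  -- `supp e' ∖ Er` splits along `W`
  have hsd : ((supp e' \ Er) \ W).card + ((supp e' \ Er) ∩ W).card = (supp e' \ Er).card :=
    card_sdiff_add_card_inter _ _
  have heq1 : (supp e' \ Er) \ W = (supp e' \ W) \ Er := by
    ext v
    simp only [Finset.mem_sdiff]
    tauto
  rw [heq1] at hsd
  have hkey : ((supp e' \ Er) ∩ W).card ≤ ((W \ supp e') \ Er).card := by omega
  -- on `W ⊆ supp (e + e')` exactly one of `e v`, `e' v` is non-zero
  have hone : ∀ v ∈ W, e v = 0 ↔ e' v ≠ 0 := by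
    intro v hv
    have h := mem_supp_iff''.1 (hW hv)
    rw [Pi.add_apply] at h
    constructor
    · intro h0 h1
      rw [h0, h1, add_zero] at h
      exact h rfl
    · intro h1
      by_contra h0
      rw [zmod2_eq_one'' h0, zmod2_eq_one'' h1] at h
      exact h (by decide)
  have hsub1 : (W \ Er) \ supp e ⊆ (supp e' \ Er) ∩ W := by
    intro v hv
    rw [Finset.mem_sdiff, Finset.mem_sdiff, mem_supp_iff'', not_not] at hv
    refine mem_inter.2 ⟨Finset.mem_sdiff.2 ⟨mem_supp_iff''.2 ((hone v hv.1.1).1 hv.2), hv.1.2⟩, hv.1.1⟩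
  have hsub2 : (W \ supp e') \ Er ⊆ (W \ Er) ∩ supp e := by
    intro v hv
    rw [Finset.mem_sdiff, Finset.mem_sdiff, mem_supp_iff'', not_not] at hv
    refine mem_inter.2 ⟨Finset.mem_sdiff.2 ⟨hv.1.1, hv.2⟩, mem_supp_iff''.2 fun h0 => ?_⟩
    exact ((hone v hv.1.1).1 h0) hv.1.2
  have hsplit : (W \ Er).card = ((W \ Er) ∩ supp e).card + ((W \ Er) \ supp e).card := by
    rw [← card_sdiff_add_card_inter (W \ Er) (supp e), add_comm]
  have h1 := card_le_card hsub1
  have h2 := card_le_card hsub2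
  omega

/-- **DKP15's bad event for the mixed channel.** If a minimum-weight-outside-the-erasure decoder fails on
`(Er, e)` — the net error `D(Er, He) + e` is not in `SX` — then some IRREDUCIBLE undetectable `U` with
`𝟙_U ∉ SX` has at least half of its non-erased qubits in error: `|U ∖ Er| ≤ 2 |(U ∖ Er) ∩ supp e|`.
[cite: DumerKovalevPryadko2015, eq. (min-E-condition) (with App. A §1.1)] -/
theorem exists_irreducible_of_mixed_failure (H : Matrix ι V (ZMod 2))
    (SX : Submodule (ZMod 2) (V → ZMod 2)) {D : ErasureDecoder V (ι → ZMod 2)}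
    (hD : D.IsMinWeightOutside H) {Er : Finset V} {e : V → ZMod 2}
    (hfail : ¬ D.Corrects (fun e => H *ᵥ e) (SX : Set (V → ZMod 2)) Er e) :
    ∃ W : Finset V, IsIrreducible H W ∧ vecOf W ∉ SX ∧ (W \ Er).card ≤ 2 * ((W \ Er) ∩ supp e).card := by
  classical
  have hsyn : H *ᵥ D Er (H *ᵥ e) = H *ᵥ e := (hD Er e).1
  have hmin := (hD Er e).2
  have hx : H *ᵥ (D Er (H *ᵥ e) + e) = 0 := by
    rw [Matrix.mulVec_add, hsyn]
    funext i
    exact CharTwo.add_self_eq_zero _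
  have hxS : D Er (H *ᵥ e) + e ∉ SX := hfail
  obtain ⟨W, hWsub, hirr, hWS⟩ := exists_irreducible_of_mulVec_eq_zero H SX hx hxS
  refine ⟨W, hirr, hWS, ?_⟩
  have hW' : W ⊆ supp (e + D Er (H *ᵥ e)) := by rwa [add_comm]
  exact card_sdiff_le_two_mul_of_minWeightOutside H hsyn hmin hW' hirr.undetectable

/-! ### The effective erasure probability `Υ_CSS(y, p)` -/

/-- `Υ_CSS(y, p) = y + 2(1-y)√(p(1-p))`, the effective erasure probability of the mixed channel.
[cite: DumerKovalevPryadko2015, Thm 2 (Υ_CSS)] -/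
noncomputable def upsilonCSS (y p : ℝ) : ℝ :=
  y + 2 * (1 - y) * Real.sqrt (p * (1 - p))

/-- **The binomial identity of App. A**: for a fixed operator `U` and a number `θ`, averaging `θ^{|U ∖ Er|}`
over independent erasures of rate `y` gives `(y + (1-y)θ)^{|U|}` ("Summation of probabilities … gives the
net … The base of the exponent is the effective erasure probability").
[cite: DumerKovalevPryadko2015, App. A §1.1 eqs. (prob-erasures-xz)–(threshold-CSS)] -/
theorem sum_bernoulliWeight_pow_card_sdiff (y θ : ℝ) (U : Finset V) :
    ∑ Er : Finset V, bernoulliWeight y Er * θ ^ (U \ Er).card = (y + (1 - y) * θ) ^ U.card := by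
  classical
  -- group the erasure patterns by their trace `A = U ∩ Er`
  have hfib : ∑ Er : Finset V, bernoulliWeight y Er * θ ^ (U \ Er).card =
      ∑ A ∈ U.powerset, ∑ Er ∈ univ.filter (fun Er : Finset V => U ∩ Er = A),
        bernoulliWeight y Er * θ ^ (U \ Er).card := by
    rw [← Finset.sum_fiberwise_of_maps_to (s := (univ : Finset (Finset V))) (t := U.powerset)
      (g := fun Er : Finset V => U ∩ Er) (fun Er _ => Finset.mem_powerset.2 Finset.inter_subset_left)]
  rw [hfib]
  have hinner : ∀ A ∈ U.powerset,
      ∑ Er ∈ univ.filter (fun Er : Finset V => U ∩ Er = A), bernoulliWeight y Er * θ ^ (U \ Er).card =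
        y ^ A.card * (1 - y) ^ (U.card - A.card) * θ ^ (U.card - A.card) := by
    intro A hA
    have hAU : A ⊆ U := Finset.mem_powerset.1 hA
    have hcongr : ∀ Er ∈ univ.filter (fun Er : Finset V => U ∩ Er = A),
        bernoulliWeight y Er * θ ^ (U \ Er).card = bernoulliWeight y Er * θ ^ (U.card - A.card) := by
      intro Er hEr
      rw [mem_filter] at hEr
      have h1 : U \ Er = U \ A := by
        rw [← hEr.2]
        ext v
        simp only [Finset.mem_sdiff, Finset.mem_inter]
        tauto
      rw [h1, card_sdiff_of_subset hAU]
    rw [Finset.sum_congr rfl hcongr, ← Finset.sum_mul]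
    have hmarg : ∑ Er ∈ univ.filter (fun Er : Finset V => U ∩ Er = A), bernoulliWeight y Er =
        y ^ A.card * (1 - y) ^ (U.card - A.card) := by
      have h := sum_bernoulliWeight_filter_inter y U (fun B => B = A)
      rw [h]
      have hfilter : U.powerset.filter (fun B => B = A) = {A} := by
        ext B
        simp only [mem_filter, Finset.mem_powerset, Finset.mem_singleton]
        constructor
        · exact fun h => h.2
        · intro h
          rw [h]
          exact ⟨hAU, rfl⟩
      rw [hfilter, Finset.sum_singleton]
    rw [hmarg]
  rw [Finset.sum_congr rfl hinner]
  have hre : ∀ A ∈ U.powerset, y ^ A.card * (1 - y) ^ (U.card - A.card) * θ ^ (U.card - A.card) =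
      y ^ A.card * ((1 - y) * θ) ^ (U.card - A.card) := by
    intro A _
    rw [mul_pow]
    ring
  rw [Finset.sum_congr rfl hre, Finset.sum_pow_mul_eq_add_pow]

/-! ### The failure probability and its bound -/

open Classical in
/-- **Failure probability of the mixed channel** (independent erasures of rate `y`, independent errors of
rate `p`; robust in the errors on the erased qubits): the probability over `(Er, E)` that SOME error `e`
agreeing with `E` on the non-erased qubits makes the decoder fail (net error `D(Er, He) + e ∉ SX`).
[cite: DumerKovalevPryadko2015, eq. (min-E-condition) (Prob[E ∈ ∪_U ℬ(U)], mixed channel)] -/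
noncomputable def mixedFailureProb (H : Matrix ι V (ZMod 2)) (SX : Set (V → ZMod 2))
    (D : ErasureDecoder V (ι → ZMod 2)) (y p : ℝ) : ℝ :=
  ∑ Er : Finset V, bernoulliWeight y Er *
    ∑ E ∈ univ.filter (fun E : Finset V => ∃ e : V → ZMod 2, supp e \ Er = E \ Er ∧
        ¬ D.Corrects (fun e => H *ᵥ e) SX Er e), bernoulliWeight p E

/-- **DKP15 Theorem 2 (one error type), finite size.** Checks of weight `≤ w` (`w ≥ 2`, `K := w-1`),
`1 ≤ d ≤ ‖x‖` for all `x ∈ ker H ∖ SX`, a minimum-weight-outside-the-erasure decoder, erasure rate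
`0 ≤ y ≤ 1`, error rate `0 ≤ p ≤ 1/2`, and `K·Υ_CSS(y,p) < 1`. Then
`mixedFailureProb ≤ Σ_U Υ^{|U|} ≤ |V| (KΥ)^d / (K (1 - KΥ))`.
[cite: DumerKovalevPryadko2015, Thm 2 (with App. A §1.1)] -/
theorem mixedFailureProb_le (H : Matrix ι V (ZMod 2)) (SX : Submodule (ZMod 2) (V → ZMod 2))
    {D : ErasureDecoder V (ι → ZMod 2)} (hD : D.IsMinWeightOutside H)
    {w : ℕ} (hw : 2 ≤ w) (hrow : ∀ i, (rowSupp H i).card ≤ w) {d : ℕ} (hd1 : 1 ≤ d)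
    (hd : ∀ x : V → ZMod 2, H *ᵥ x = 0 → x ∉ SX → d ≤ hammingNorm x)
    {y p : ℝ} (hy0 : 0 ≤ y) (hy1 : y ≤ 1) (hp0 : 0 ≤ p) (hp : p ≤ 1 / 2)
    (hr : ((w - 1 : ℕ) : ℝ) * upsilonCSS y p < 1) :
    mixedFailureProb H (SX : Set (V → ZMod 2)) D y p ≤
      (Fintype.card V : ℝ) * (((w - 1 : ℕ) : ℝ) * upsilonCSS y p) ^ d /
        (((w - 1 : ℕ) : ℝ) * (1 - ((w - 1 : ℕ) : ℝ) * upsilonCSS y p)) := by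
  classical
  set s : ℝ := Real.sqrt (p * (1 - p)) with hs
  have hs0 : 0 ≤ s := Real.sqrt_nonneg _
  have hΥ : upsilonCSS y p = y + (1 - y) * (2 * s) := by rw [upsilonCSS, hs]; ring
  have hΥ0 : 0 ≤ upsilonCSS y p := by rw [hΥ]; nlinarith
  set Ps : Finset (Finset V) := univ.filter (fun W => IsIrreducible H W ∧ d ≤ W.card) with hPs
  -- Step 1: for every erasure pattern, the inner sum is covered by the bad events `ℬ(U)`
  have hinner : ∀ Er : Finset V,
      ∑ E ∈ univ.filter (fun E : Finset V => ∃ e : V → ZMod 2, supp e \ Er = E \ Er ∧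
          ¬ D.Corrects (fun e => H *ᵥ e) (SX : Set (V → ZMod 2)) Er e), bernoulliWeight p E ≤
        ∑ W ∈ Ps, (2 * s) ^ (W \ Er).card := by
    intro Er
    refine sum_bernoulliWeight_le_of_cover hp0 hp Ps (fun W : Finset V => W \ Er) _ fun E hE => ?_
    rw [mem_filter] at hE
    obtain ⟨e, heE, hfail⟩ := hE.2
    obtain ⟨W, hirr, hWS, hhalf⟩ := exists_irreducible_of_mixed_failure H SX hD hfail
    refine ⟨W, ?_, ?_⟩
    · rw [hPs, mem_filter]
      exact ⟨mem_univ _, hirr, hirr.le_card hd hWS⟩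
    · -- `(W ∖ Er) ∩ supp e = (W ∖ Er) ∩ E` since `supp e` and `E` agree off `Er`
      have hsame : (W \ Er) ∩ supp e = (W \ Er) ∩ E := by
        ext v
        simp only [Finset.mem_inter, Finset.mem_sdiff]
        constructor
        · rintro ⟨⟨hvW, hvEr⟩, hve⟩
          have : v ∈ supp e \ Er := Finset.mem_sdiff.2 ⟨hve, hvEr⟩
          rw [heE] at this
          exact ⟨⟨hvW, hvEr⟩, (Finset.mem_sdiff.1 this).1⟩
        · rintro ⟨⟨hvW, hvEr⟩, hvE⟩
          have : v ∈ E \ Er := Finset.mem_sdiff.2 ⟨hvE, hvEr⟩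
          rw [← heE] at this
          exact ⟨⟨hvW, hvEr⟩, (Finset.mem_sdiff.1 this).1⟩
      rw [← hsame]
      exact hhalf
  -- Step 2: average over the erasures
  have hnn : ∀ Er : Finset V, 0 ≤ bernoulliWeight y Er := bernoulliWeight_nonneg hy0 hy1
  have h2 : mixedFailureProb H (SX : Set (V → ZMod 2)) D y p ≤
      ∑ Er : Finset V, bernoulliWeight y Er * ∑ W ∈ Ps, (2 * s) ^ (W \ Er).card := by
    unfold mixedFailureProb
    exact Finset.sum_le_sum fun Er _ => mul_le_mul_of_nonneg_left (hinner Er) (hnn Er)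
  -- Step 3: swap the sums and use the binomial identity
  have h3 : ∑ Er : Finset V, bernoulliWeight y Er * ∑ W ∈ Ps, (2 * s) ^ (W \ Er).card =
      ∑ W ∈ Ps, upsilonCSS y p ^ W.card := by
    simp_rw [Finset.mul_sum]
    rw [Finset.sum_comm]
    refine Finset.sum_congr rfl fun W _ => ?_
    rw [sum_bernoulliWeight_pow_card_sdiff, hΥ]
  -- Step 4: the irreducible-cluster count
  have h4 := sum_pow_card_irreducible_le H hw hrow hd1 hΥ0 hr
  exact h2.trans (h3.le.trans h4)

/-! ### The threshold statement for code families -/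

section Family

variable {n m : ℕ → ℕ}

/-- **DKP15 Theorem 2 as a certified statement** (one error type, power-law-or-faster distance): for a
family of CSS codes with checks of weight `≤ w` (`w ≥ 2`), `1 ≤ d_i ≤` distance,
minimum-weight-outside-the-erasure decoders `D i`, and SIZE SUBEXPONENTIAL IN THE DISTANCE (`n_i r^{d_i} → 0`
for every `0 < r < 1`), every pair of rates `0 ≤ y ≤ 1`, `0 ≤ p ≤ 1/2` with
`(w-1)·(y + 2(1-y)√(p(1-p))) < 1` has `mixedFailureProb → 0` ("can be decoded with vanishing error
probabilities"). [cite: DumerKovalevPryadko2015, Thm 2] -/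
theorem cssMixedThreshold (H : ∀ i, Matrix (Fin (m i)) (Fin (n i)) (ZMod 2))
    (SX : ∀ i, Submodule (ZMod 2) (Fin (n i) → ZMod 2))
    (D : ∀ i, ErasureDecoder (Fin (n i)) (Fin (m i) → ZMod 2)) (hD : ∀ i, (D i).IsMinWeightOutside (H i))
    {w : ℕ} (hw : 2 ≤ w) (hrow : ∀ i j, (rowSupp (H i) j).card ≤ w) (d : ℕ → ℕ) (hd1 : ∀ i, 1 ≤ d i)
    (hd : ∀ i (x : Fin (n i) → ZMod 2), H i *ᵥ x = 0 → x ∉ SX i → d i ≤ hammingNorm x)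
    (hgrowth : ∀ r : ℝ, 0 < r → r < 1 → Tendsto (fun i => (n i : ℝ) * r ^ d i) atTop (𝓝 0))
    {y p : ℝ} (hy0 : 0 ≤ y) (hy1 : y ≤ 1) (hp0 : 0 ≤ p) (hp : p ≤ 1 / 2)
    (hr : ((w - 1 : ℕ) : ℝ) * upsilonCSS y p < 1) :
    Tendsto (fun i => mixedFailureProb (H i) (SX i : Set (Fin (n i) → ZMod 2)) (D i) y p)
      atTop (𝓝 0) := by
  classical
  set K : ℝ := ((w - 1 : ℕ) : ℝ) with hK
  have hK1 : 1 ≤ K := by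
    rw [hK]
    exact_mod_cast (show 1 ≤ w - 1 by omega)
  have hK0 : 0 < K := by linarith
  set r : ℝ := K * upsilonCSS y p with hrdef
  have hΥ0 : 0 ≤ upsilonCSS y p := by
    unfold upsilonCSS
    have := Real.sqrt_nonneg (p * (1 - p))
    nlinarith
  have hr0 : 0 ≤ r := by positivity
  have h1r : 0 < 1 - r := by linarith
  have hp1 : p ≤ 1 := by linarith
  have hbound : ∀ i, mixedFailureProb (H i) (SX i : Set (Fin (n i) → ZMod 2)) (D i) y p ≤
      (n i : ℝ) * r ^ d i / (K * (1 - r)) := by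
    intro i
    have h := mixedFailureProb_le (H i) (SX i) (hD i) hw (hrow i) (hd1 i) (hd i) hy0 hy1 hp0 hp hr
    rw [Fintype.card_fin] at h
    exact h
  have hnonneg : ∀ i, 0 ≤ mixedFailureProb (H i) (SX i : Set (Fin (n i) → ZMod 2)) (D i) y p := by
    intro i
    unfold mixedFailureProb
    exact Finset.sum_nonneg fun Er _ => mul_nonneg (bernoulliWeight_nonneg hy0 hy1 _)
      (Finset.sum_nonneg fun E _ => bernoulliWeight_nonneg hp0 hp1 _)
  have hQ : Tendsto (fun i => (n i : ℝ) * r ^ d i / (K * (1 - r))) atTop (𝓝 0) := by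
    rcases hr0.eq_or_lt with hr00 | hrpos
    · have : (fun i => (n i : ℝ) * r ^ d i / (K * (1 - r))) = fun _ => 0 := by
        funext i
        rw [← hr00, zero_pow (by have := hd1 i; omega)]
        simp
      rw [this]
      exact tendsto_const_nhds
    · have h := (hgrowth r hrpos hr).div_const (K * (1 - r))
      simpa using h
  exact squeeze_zero hnonneg hbound hQ

end Family

end Literature.InformationTheory.QuantumCodes
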